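import Summits.CriticalPhenomena.PercolationContinuityZ3.Theorems.PercNearOneGluingNoHeavyLowerTailSahiTangentCylinderFourPoly
import Summits.CriticalPhenomena.PercolationContinuityZ3.Theorems.PercNearOneGluingNoHeavyLowerTailSahiTangentCylinderPairs

/-!
# `NoHeavyLowerTail` (crux stmt-CriticalPhenomena-4575), Sahi programme: **THE ORDER-4 CONTRACTION INEQUALITY FOR CYLINDER PAIRS ON EVERY CUBE —
# part 2: the reduction on the cube** (`Δ₄(s) ≥ 0` by erasure to frozen configurations; induction on `excess4`)

Support file (Sahi cell, seat `prim-sahi-p1`, generation 49; `--supports stmt-CriticalPhenomena-4575`).  Pure proofs, standard axioms, no `sorry`;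
the definitions are the polynomial `D4cyl` (the contraction defect `Δ₄(s)` of four cylinder pairs in the masses `cylMass`) and the termination
measure `excess4` (used in part 3).  Part 1 (`…SahiTangentCylinderFourPoly`) has the real inequalities; part 3 (`…SahiTangentCylinderFourFrozen`) does the frozen case and the induction; part 4 (`…SahiTangentCylinderFourBridge`) identifies `D4cyl`
with `E₄^{B_s⊗μ}(F) − s·E₄^{μ}(tops)` for `μ = bernoulliWeight q` and discharges the `C₄` hypothesis.

THE RESULT (`D4cyl_nonneg`).  For every cube `{0,1}^ι`, every `p : ι → [0,1]`, every `s ∈ [0,1]` and all cylinder pairs `t_l ⊆ b_l` (`l < 4`):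
if `E₄ ≥ 0` for the four top cylinders (Sahi's `C₄` for cylinders, a theorem of the tree, supplied in part 3), then `Δ₄(s) = E₄(M) − s·E₄(X) ≥ 0`,
`M_S = s·M(∪_{l∈S}t_l) + (1−s)·M(∪_{l∈S}b_l)`.  PROOF: `Δ₄` is affine in the group of bottom masses `{Y_S : S ∋ l}` with coefficients
`−(1−s)·E₃(M; others)`, `−(1−s)·Cov(M; others)`, `−2(1−s)·M_other` (all `≤ 0` by part 1's `coin_E3_nonneg` = gen 48's cylinder-pair theorem,
`coin_cov_nonneg`, positivity) and `+6(1−s)` on `Y_{0123}`; erasing from `b_l` a coordinate lying in another bottom raises the `Y_S`, `S ∋ l`, `S ≠ [4]`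
and fixes `Y_{0123}`, so it lowers `Δ₄` (`D4cyl_erase_le₀…₃`); when no such coordinate is left the configuration is FROZEN, the bottom masses factor
and part 1's `frozen4_nonneg` applies (`D4cyl_nonneg_of_frozen`). [this work]
-/

namespace Summit.CriticalPhenomena.PercolationContinuityZ3.Theorems.SahiTangentCyl

open Finset
open scoped BigOperators

noncomputable section

variable {ι : Type*} [DecidableEq ι] {p : ι → ℝ}

/-! ### The order-4 contraction defect for four cylinder pairs -/

/-- **`Δ₄(s)` for four cylinder pairs** `t_l ⊆ b_l`: `E₄(M) − s·E₄(X)` with `X_S = M(∪_{l∈S} t_l)`, `Y_S = M(∪_{l∈S} b_l)`, `M_S = sX_S + (1−s)Y_S`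
(`E₄` = the fifteen-term fourth Sahi functional in the moments, `…Sahi2008.Functional.sahiE_four`). [this work] -/
def D4cyl (p : ι → ℝ) (s : ℝ) (t b : Fin 4 → Finset ι) : ℝ :=
  6 * (s * cylMass p (t 0 ∪ t 1 ∪ t 2 ∪ t 3) + (1 - s) * cylMass p (b 0 ∪ b 1 ∪ b 2 ∪ b 3)) - 2 * (s * cylMass p (t 0) + (1 - s) * cylMass p (b 0)) * (s * cylMass p (t 1 ∪ t 2 ∪ t 3) + (1 - s) * cylMass p (b 1 ∪ b 2 ∪ b 3)) - (s * cylMass p (t 0 ∪ t 1) + (1 - s) * cylMass p (b 0 ∪ b 1)) * (s * cylMass p (t 2 ∪ t 3) + (1 - s) * cylMass p (b 2 ∪ b 3)) - 2 * (s * cylMass p (t 1) + (1 - s) * cylMass p (b 1)) * (s * cylMass p (t 0 ∪ t 2 ∪ t 3) + (1 - s) * cylMass p (b 0 ∪ b 2 ∪ b 3)) + (s * cylMass p (t 0) + (1 - s) * cylMass p (b 0)) * (s * cylMass p (t 1) + (1 - s) * cylMass p (b 1)) * (s * cylMass p (t 2 ∪ t 3) + (1 - s) * cylMass p (b 2 ∪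 b 3)) - 2 * (s * cylMass p (t 3) + (1 - s) * cylMass p (b 3)) * (s * cylMass p (t 0 ∪ t 1 ∪ t 2) + (1 - s) * cylMass p (b 0 ∪ b 1 ∪ b 2)) - (s * cylMass p (t 0 ∪ t 3) + (1 - s) * cylMass p (b 0 ∪ b 3)) * (s * cylMass p (t 1 ∪ t 2) + (1 - s) * cylMass p (b 1 ∪ b 2)) + (s * cylMass p (t 0) + (1 - s) * cylMass p (b 0)) * (s * cylMass p (t 3) + (1 - s) * cylMass p (b 3)) * (s * cylMass p (t 1 ∪ t 2) + (1 - s) * cylMass p (b 1 ∪ b 2)) - (s * cylMass p (t 0 ∪ t 2) + (1 - s) * cylMass p (b 0 ∪ b 2)) * (s * cylMass p (t 1 ∪ t 3) + (1 - s) * cylMass p (b 1 ∪ b 3)) - 2 * (s * cylMass p (t 2) + (1 - s) * cylMass p (b 2)) * (s * cylMass p (t 0 ∪ t 1 ∪ t 3) + (1 - s) * cylMass p (b 0 ∪ b 1 ∪ b 3)) + (s * cylMass p (t 0) + (1 - s) * cylMass p (b 0)) * (s * cylMass p (t 2) + (1 - s) * cylMass p (b 2)) * (s * cylMass p (t 1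 ∪ t 3) + (1 - s) * cylMass p (b 1 ∪ b 3)) + (s * cylMass p (t 2) + (1 - s) * cylMass p (b 2)) * (s * cylMass p (t 3) + (1 - s) * cylMass p (b 3)) * (s * cylMass p (t 0 ∪ t 1) + (1 - s) * cylMass p (b 0 ∪ b 1)) + (s * cylMass p (t 1) + (1 - s) * cylMass p (b 1)) * (s * cylMass p (t 3) + (1 - s) * cylMass p (b 3)) * (s * cylMass p (t 0 ∪ t 2) + (1 - s) * cylMass p (b 0 ∪ b 2)) + (s * cylMass p (t 1) + (1 - s) * cylMass p (b 1)) * (s * cylMass p (t 2) + (1 - s) * cylMass p (b 2)) * (s * cylMass p (t 0 ∪ t 3) + (1 - s) * cylMass p (b 0 ∪ b 3)) - (s * cylMass p (t 0) + (1 - s) * cylMass p (b 0)) * (s * cylMass p (t 1) + (1 - s) * cylMass p (b 1)) * (s * cylMass p (t 2) + (1 - s) * cylMass p (b 2)) * (s * cylMass p (t 3) + (1 - s) * cylMass p (b 3))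
    - s * (6 * cylMass p (t 0 ∪ t 1 ∪ t 2 ∪ t 3) - 2 * cylMass p (t 0) * cylMass p (t 1 ∪ t 2 ∪ t 3) - cylMass p (t 0 ∪ t 1) * cylMass p (t 2 ∪ t 3) - 2 * cylMass p (t 1) * cylMass p (t 0 ∪ t 2 ∪ t 3) + cylMass p (t 0) * cylMass p (t 1) * cylMass p (t 2 ∪ t 3) - 2 * cylMass p (t 3) * cylMass p (t 0 ∪ t 1 ∪ t 2) - cylMass p (t 0 ∪ t 3) * cylMass p (t 1 ∪ t 2) + cylMass p (t 0) * cylMass p (t 3) * cylMass p (t 1 ∪ t 2) - cylMass p (t 0 ∪ t 2) * cylMass p (t 1 ∪ t 3) - 2 * cylMass p (t 2) * cylMass p (t 0 ∪ t 1 ∪ t 3) + cylMass p (t 0) * cylMass p (t 2) * cylMass p (t 1 ∪ t 3) + cylMass p (t 2) * cylMass p (t 3) * cylMass p (t 0 ∪ t 1) + cylMass p (t 1) * cylMass p (t 3) * cylMass p (t 0 ∪ t 2) + cylMass p (t 1) * cylMass p (t 2) * cylMass p (t 0 ∪ t 3) - cylMass p (t 0) * cylMass p (t 1) * cylMass p (t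 2) * cylMass p (t 3))

/-- The termination measure: the number of defect coordinates lying in another bottom. [this work] -/
def excess4 (t b : Fin 4 → Finset ι) : ℕ :=
  ((b 0 \ t 0) ∩ (b 1 ∪ b 2 ∪ b 3)).card + ((b 1 \ t 1) ∩ (b 0 ∪ b 2 ∪ b 3)).card + ((b 2 \ t 2) ∩ (b 0 ∪ b 1 ∪ b 3)).card + ((b 3 \ t 3) ∩ (b 0 ∪ b 1 ∪ b 2)).card

/-- Erasing from `b 0` a point of the other bottoms does not change the fourfold union. [this work] -/
theorem union₄_erase₀ {b : Fin 4 → Finset ι} {e : ι} (h : e ∈ b 1 ∪ b 2 ∪ b 3) :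
    (b 0).erase e ∪ b 1 ∪ b 2 ∪ b 3 = b 0 ∪ b 1 ∪ b 2 ∪ b 3 := by
  ext x
  simp only [mem_union] at h
  simp only [mem_union, mem_erase]
  by_cases hxe : x = e
  · subst hxe; tauto
  · tauto

/-- Erasing from `b 1` a point of the other bottoms does not change the fourfold union. [this work] -/
theorem union₄_erase₁ {b : Fin 4 → Finset ι} {e : ι} (h : e ∈ b 0 ∪ b 2 ∪ b 3) :
    b 0 ∪ (b 1).erase e ∪ b 2 ∪ b 3 = b 0 ∪ b 1 ∪ b 2 ∪ b 3 := by
  ext x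
  simp only [mem_union] at h
  simp only [mem_union, mem_erase]
  by_cases hxe : x = e
  · subst hxe; tauto
  · tauto

/-- Erasing from `b 2` a point of the other bottoms does not change the fourfold union. [this work] -/
theorem union₄_erase₂ {b : Fin 4 → Finset ι} {e : ι} (h : e ∈ b 0 ∪ b 1 ∪ b 3) :
    b 0 ∪ b 1 ∪ (b 2).erase e ∪ b 3 = b 0 ∪ b 1 ∪ b 2 ∪ b 3 := by
  ext x
  simp only [mem_union] at h
  simp only [mem_union, mem_erase]
  by_cases hxe : x = e
  · subst hxe; tauto
  · tauto

/-- Erasing from `b 3` a point of the other bottoms does not change the fourfold union. [this work] -/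
theorem union₄_erase₃ {b : Fin 4 → Finset ι} {e : ι} (h : e ∈ b 0 ∪ b 1 ∪ b 2) :
    b 0 ∪ b 1 ∪ b 2 ∪ (b 3).erase e = b 0 ∪ b 1 ∪ b 2 ∪ b 3 := by
  ext x
  simp only [mem_union] at h
  simp only [mem_union, mem_erase]
  by_cases hxe : x = e
  · subst hxe; tauto
  · tauto

variable [Fintype ι]

/-- **Reduction step at slot `0`**: erasing from `b 0` a coordinate of another bottom can only decrease `Δ₄(s)`. [this work] -/
theorem D4cyl_erase_le₀ (hp0 : ∀ e, 0 ≤ p e) (hp1 : ∀ e, p e ≤ 1) {s : ℝ} (hs0 : 0 ≤ s) (hs1 : s ≤ 1)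
    (t b : Fin 4 → Finset ι) (htb : ∀ l, t l ⊆ b l) {e : ι} (he : e ∈ b 1 ∪ b 2 ∪ b 3) :
    D4cyl p s t (Function.update b 0 ((b 0).erase e)) ≤ D4cyl p s t b := by
  have n10 : (1 : Fin 4) ≠ 0 := by decide
  have n20 : (2 : Fin 4) ≠ 0 := by decide
  have n30 : (3 : Fin 4) ≠ 0 := by decide
  have h1s : 0 ≤ 1 - s := sub_nonneg.2 hs1
  unfold D4cyl
  rw [Function.update_self, Function.update_of_ne n10, Function.update_of_ne n20, Function.update_of_ne n30, union₄_erase₀ he]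
  have u0 : cylMass p (b 0) ≤ cylMass p ((b 0).erase e) := cylMass_anti hp0 hp1 (erase_subset e (b 0))
  have u01 : cylMass p (b 0 ∪ b 1) ≤ cylMass p ((b 0).erase e ∪ b 1) := cylMass_anti hp0 hp1 (union_subset_union (erase_subset e (b 0)) subset_rfl)
  have u02 : cylMass p (b 0 ∪ b 2) ≤ cylMass p ((b 0).erase e ∪ b 2) := cylMass_anti hp0 hp1 (union_subset_union (erase_subset e (b 0)) subset_rfl)
  have u03 : cylMass p (b 0 ∪ b 3) ≤ cylMass p ((b 0).erase e ∪ b 3) := cylMass_anti hp0 hp1 (union_subset_union (erase_subset e (b 0)) subset_rfl)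
  have u012 : cylMass p (b 0 ∪ b 1 ∪ b 2) ≤ cylMass p ((b 0).erase e ∪ b 1 ∪ b 2) := cylMass_anti hp0 hp1 (union_subset_union (union_subset_union (erase_subset e (b 0)) subset_rfl) subset_rfl)
  have u013 : cylMass p (b 0 ∪ b 1 ∪ b 3) ≤ cylMass p ((b 0).erase e ∪ b 1 ∪ b 3) := cylMass_anti hp0 hp1 (union_subset_union (union_subset_union (erase_subset e (b 0)) subset_rfl) subset_rfl)
  have u023 : cylMass p (b 0 ∪ b 2 ∪ b 3) ≤ cylMass p ((b 0).erase e ∪ b 2 ∪ b 3) := cylMass_anti hp0 hp1 (union_subset_union (union_subset_union (erase_subset e (b 0)) subset_rfl) subset_rfl)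
  -- the coefficients: `E₃(M; others) ≥ 0` (gen 48 under the coin), `Cov(M; ·,·) ≥ 0`, `M ≥ 0`
  have d1 : cylMass p (b 1) ≤ cylMass p (t 1) := cylMass_anti hp0 hp1 (htb 1)
  have d2 : cylMass p (b 2) ≤ cylMass p (t 2) := cylMass_anti hp0 hp1 (htb 2)
  have d3 : cylMass p (b 3) ≤ cylMass p (t 3) := cylMass_anti hp0 hp1 (htb 3)
  have hEX : 0 ≤ 2 * cylMass p (t 1 ∪ t 2 ∪ t 3) - cylMass p (t 1) * cylMass p (t 2 ∪ t 3) - cylMass p (t 3) * cylMass p (t 1 ∪ t 2) - cylMass p (t 2) * cylMass p (t 1 ∪ t 3) + cylMass p (t 1) * cylMass p (t 2) * cylMass p (t 3) := by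
    have h := E3cyl_nonneg hp0 hp1 ![t 1, t 2, t 3]
    simp only [Matrix.cons_val_zero, Matrix.cons_val_one, Matrix.cons_val_two, Matrix.head_cons, Matrix.tail_cons] at h
    linarith
  have hEY : 0 ≤ 2 * cylMass p (b 1 ∪ b 2 ∪ b 3) - cylMass p (b 1) * cylMass p (b 2 ∪ b 3) - cylMass p (b 3) * cylMass p (b 1 ∪ b 2) - cylMass p (b 2) * cylMass p (b 1 ∪ b 3) + cylMass p (b 1) * cylMass p (b 2) * cylMass p (b 3) := by
    have h := E3cyl_nonneg hp0 hp1 ![b 1, b 2, b 3]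
    simp only [Matrix.cons_val_zero, Matrix.cons_val_one, Matrix.cons_val_two, Matrix.head_cons, Matrix.tail_cons] at h
    linarith
  have hT : 0 ≤ 2 * cylMass p (b 1 ∪ b 2 ∪ b 3) + cylMass p (t 1) * cylMass p (t 2 ∪ t 3) - cylMass p (t 1) * cylMass p (b 2 ∪ b 3) - cylMass p (t 2) * cylMass p (b 1 ∪ b 3) - cylMass p (t 3) * cylMass p (b 1 ∪ b 2) + cylMass p (t 3) * cylMass p (t 1 ∪ t 2) - cylMass p (t 1 ∪ t 2) * cylMass p (b 3) + cylMass p (t 2) * cylMass p (t 1 ∪ t 3) - cylMass p (t 1 ∪ t 3) * cylMass p (b 2) - cylMass p (t 2 ∪ t 3) * cylMass p (b 1) - 2 * cylMass p (t 1) * cylMass p (t 2) * cylMass p (t 3) + cylMass p (t 1) * cylMass p (t 2) * cylMass p (b 3) + cylMass p (t 1) * cylMass p (t 3) * cylMass p (b 2) + cylMass p (t 2) * cylMass p (t 3) * cylMass p (b 1) := by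
    have h := T3cyl_nonneg hp0 hp1 (t := ![t 1, t 2, t 3]) (b := ![b 1, b 2, b 3]) (fun l => by fin_cases l <;> exact htb _)
    unfold T3cyl at h
    simp only [Matrix.cons_val_zero, Matrix.cons_val_one, Matrix.cons_val_two, Matrix.head_cons, Matrix.tail_cons] at h
    linarith
  have hE3 := coin_E3_nonneg hs0 hs1 d1 d2 d3 hEX hEY hT
  have hC12 := coin_cov_nonneg (s := s) hs0 hs1 d1 d2 (cylMass_mul_le_union hp0 hp1 (t 1) (t 2)) (cylMass_mul_le_union hp0 hp1 (b 1) (b 2))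
  have hC13 := coin_cov_nonneg (s := s) hs0 hs1 d1 d3 (cylMass_mul_le_union hp0 hp1 (t 1) (t 3)) (cylMass_mul_le_union hp0 hp1 (b 1) (b 3))
  have hC23 := coin_cov_nonneg (s := s) hs0 hs1 d2 d3 (cylMass_mul_le_union hp0 hp1 (t 2) (t 3)) (cylMass_mul_le_union hp0 hp1 (b 2) (b 3))
  have hM1 : 0 ≤ (s * cylMass p (t 1) + (1 - s) * cylMass p (b 1)) := add_nonneg (mul_nonneg hs0 (cylMass_nonneg hp0 _)) (mul_nonneg h1s (cylMass_nonneg hp0 _))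
  have hM2 : 0 ≤ (s * cylMass p (t 2) + (1 - s) * cylMass p (b 2)) := add_nonneg (mul_nonneg hs0 (cylMass_nonneg hp0 _)) (mul_nonneg h1s (cylMass_nonneg hp0 _))
  have hM3 : 0 ≤ (s * cylMass p (t 3) + (1 - s) * cylMass p (b 3)) := add_nonneg (mul_nonneg hs0 (cylMass_nonneg hp0 _)) (mul_nonneg h1s (cylMass_nonneg hp0 _))
  linarith [mul_nonneg (mul_nonneg h1s hE3) (sub_nonneg.2 u0), mul_nonneg (mul_nonneg h1s (sub_nonneg.2 hC23)) (sub_nonneg.2 u01), mul_nonneg (mul_nonneg h1s (sub_nonneg.2 hC13)) (sub_nonneg.2 u02), mul_nonneg (mul_nonneg h1s (sub_nonneg.2 hC12)) (sub_nonneg.2 u03), mul_nonneg (mul_nonneg h1s hM3) (sub_nonneg.2 u012), mul_nonneg (mul_nonneg h1s hM2) (sub_nonneg.2 u013), mul_nonneg (mul_nonneg h1s hM1) (sub_nonneg.2 u023)]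

/-- **Reduction step at slot `1`**: erasing from `b 1` a coordinate of another bottom can only decrease `Δ₄(s)`. [this work] -/
theorem D4cyl_erase_le₁ (hp0 : ∀ e, 0 ≤ p e) (hp1 : ∀ e, p e ≤ 1) {s : ℝ} (hs0 : 0 ≤ s) (hs1 : s ≤ 1)
    (t b : Fin 4 → Finset ι) (htb : ∀ l, t l ⊆ b l) {e : ι} (he : e ∈ b 0 ∪ b 2 ∪ b 3) :
    D4cyl p s t (Function.update b 1 ((b 1).erase e)) ≤ D4cyl p s t b := by
  have n01 : (0 : Fin 4) ≠ 1 := by decide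
  have n21 : (2 : Fin 4) ≠ 1 := by decide
  have n31 : (3 : Fin 4) ≠ 1 := by decide
  have h1s : 0 ≤ 1 - s := sub_nonneg.2 hs1
  unfold D4cyl
  rw [Function.update_self, Function.update_of_ne n01, Function.update_of_ne n21, Function.update_of_ne n31, union₄_erase₁ he]
  have u1 : cylMass p (b 1) ≤ cylMass p ((b 1).erase e) := cylMass_anti hp0 hp1 (erase_subset e (b 1))
  have u01 : cylMass p (b 0 ∪ b 1) ≤ cylMass p (b 0 ∪ (b 1).erase e) := cylMass_anti hp0 hp1 (union_subset_union subset_rfl (erase_subset e (b 1)))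
  have u12 : cylMass p (b 1 ∪ b 2) ≤ cylMass p ((b 1).erase e ∪ b 2) := cylMass_anti hp0 hp1 (union_subset_union (erase_subset e (b 1)) subset_rfl)
  have u13 : cylMass p (b 1 ∪ b 3) ≤ cylMass p ((b 1).erase e ∪ b 3) := cylMass_anti hp0 hp1 (union_subset_union (erase_subset e (b 1)) subset_rfl)
  have u012 : cylMass p (b 0 ∪ b 1 ∪ b 2) ≤ cylMass p (b 0 ∪ (b 1).erase e ∪ b 2) := cylMass_anti hp0 hp1 (union_subset_union (union_subset_union subset_rfl (erase_subset e (b 1))) subset_rfl)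
  have u013 : cylMass p (b 0 ∪ b 1 ∪ b 3) ≤ cylMass p (b 0 ∪ (b 1).erase e ∪ b 3) := cylMass_anti hp0 hp1 (union_subset_union (union_subset_union subset_rfl (erase_subset e (b 1))) subset_rfl)
  have u123 : cylMass p (b 1 ∪ b 2 ∪ b 3) ≤ cylMass p ((b 1).erase e ∪ b 2 ∪ b 3) := cylMass_anti hp0 hp1 (union_subset_union (union_subset_union (erase_subset e (b 1)) subset_rfl) subset_rfl)
  -- the coefficients: `E₃(M; others) ≥ 0` (gen 48 under the coin), `Cov(M; ·,·) ≥ 0`, `M ≥ 0`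
  have d0 : cylMass p (b 0) ≤ cylMass p (t 0) := cylMass_anti hp0 hp1 (htb 0)
  have d2 : cylMass p (b 2) ≤ cylMass p (t 2) := cylMass_anti hp0 hp1 (htb 2)
  have d3 : cylMass p (b 3) ≤ cylMass p (t 3) := cylMass_anti hp0 hp1 (htb 3)
  have hEX : 0 ≤ 2 * cylMass p (t 0 ∪ t 2 ∪ t 3) - cylMass p (t 0) * cylMass p (t 2 ∪ t 3) - cylMass p (t 3) * cylMass p (t 0 ∪ t 2) - cylMass p (t 2) * cylMass p (t 0 ∪ t 3) + cylMass p (t 0) * cylMass p (t 2) * cylMass p (t 3) := by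
    have h := E3cyl_nonneg hp0 hp1 ![t 0, t 2, t 3]
    simp only [Matrix.cons_val_zero, Matrix.cons_val_one, Matrix.cons_val_two, Matrix.head_cons, Matrix.tail_cons] at h
    linarith
  have hEY : 0 ≤ 2 * cylMass p (b 0 ∪ b 2 ∪ b 3) - cylMass p (b 0) * cylMass p (b 2 ∪ b 3) - cylMass p (b 3) * cylMass p (b 0 ∪ b 2) - cylMass p (b 2) * cylMass p (b 0 ∪ b 3) + cylMass p (b 0) * cylMass p (b 2) * cylMass p (b 3) := by
    have h := E3cyl_nonneg hp0 hp1 ![b 0, b 2, b 3]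
    simp only [Matrix.cons_val_zero, Matrix.cons_val_one, Matrix.cons_val_two, Matrix.head_cons, Matrix.tail_cons] at h
    linarith
  have hT : 0 ≤ 2 * cylMass p (b 0 ∪ b 2 ∪ b 3) + cylMass p (t 0) * cylMass p (t 2 ∪ t 3) - cylMass p (t 0) * cylMass p (b 2 ∪ b 3) - cylMass p (t 2) * cylMass p (b 0 ∪ b 3) - cylMass p (t 3) * cylMass p (b 0 ∪ b 2) + cylMass p (t 3) * cylMass p (t 0 ∪ t 2) - cylMass p (t 0 ∪ t 2) * cylMass p (b 3) + cylMass p (t 2) * cylMass p (t 0 ∪ t 3) - cylMass p (t 0 ∪ t 3) * cylMass p (b 2) - cylMass p (t 2 ∪ t 3) * cylMass p (b 0) - 2 * cylMass p (t 0) * cylMass p (t 2) * cylMass p (t 3) + cylMass p (t 0) * cylMass p (t 2) * cylMass p (b 3) + cylMass p (t 0) * cylMass p (t 3) * cylMass p (b 2) + cylMass p (t 2) * cylMass p (t 3) * cylMass p (b 0) := by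
    have h := T3cyl_nonneg hp0 hp1 (t := ![t 0, t 2, t 3]) (b := ![b 0, b 2, b 3]) (fun l => by fin_cases l <;> exact htb _)
    unfold T3cyl at h
    simp only [Matrix.cons_val_zero, Matrix.cons_val_one, Matrix.cons_val_two, Matrix.head_cons, Matrix.tail_cons] at h
    linarith
  have hE3 := coin_E3_nonneg hs0 hs1 d0 d2 d3 hEX hEY hT
  have hC02 := coin_cov_nonneg (s := s) hs0 hs1 d0 d2 (cylMass_mul_le_union hp0 hp1 (t 0) (t 2)) (cylMass_mul_le_union hp0 hp1 (b 0) (b 2))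
  have hC03 := coin_cov_nonneg (s := s) hs0 hs1 d0 d3 (cylMass_mul_le_union hp0 hp1 (t 0) (t 3)) (cylMass_mul_le_union hp0 hp1 (b 0) (b 3))
  have hC23 := coin_cov_nonneg (s := s) hs0 hs1 d2 d3 (cylMass_mul_le_union hp0 hp1 (t 2) (t 3)) (cylMass_mul_le_union hp0 hp1 (b 2) (b 3))
  have hM0 : 0 ≤ (s * cylMass p (t 0) + (1 - s) * cylMass p (b 0)) := add_nonneg (mul_nonneg hs0 (cylMass_nonneg hp0 _)) (mul_nonneg h1s (cylMass_nonneg hp0 _))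
  have hM2 : 0 ≤ (s * cylMass p (t 2) + (1 - s) * cylMass p (b 2)) := add_nonneg (mul_nonneg hs0 (cylMass_nonneg hp0 _)) (mul_nonneg h1s (cylMass_nonneg hp0 _))
  have hM3 : 0 ≤ (s * cylMass p (t 3) + (1 - s) * cylMass p (b 3)) := add_nonneg (mul_nonneg hs0 (cylMass_nonneg hp0 _)) (mul_nonneg h1s (cylMass_nonneg hp0 _))
  linarith [mul_nonneg (mul_nonneg h1s hE3) (sub_nonneg.2 u1), mul_nonneg (mul_nonneg h1s (sub_nonneg.2 hC23)) (sub_nonneg.2 u01), mul_nonneg (mul_nonneg h1s (sub_nonneg.2 hC03)) (sub_nonneg.2 u12), mul_nonneg (mul_nonneg h1s (sub_nonneg.2 hC02)) (sub_nonneg.2 u13), mul_nonneg (mul_nonneg h1s hM3) (sub_nonneg.2 u012), mul_nonneg (mul_nonneg h1s hM2) (sub_nonneg.2 u013), mul_nonneg (mul_nonneg h1s hM0) (sub_nonneg.2 u123)]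

/-- **Reduction step at slot `2`**: erasing from `b 2` a coordinate of another bottom can only decrease `Δ₄(s)`. [this work] -/
theorem D4cyl_erase_le₂ (hp0 : ∀ e, 0 ≤ p e) (hp1 : ∀ e, p e ≤ 1) {s : ℝ} (hs0 : 0 ≤ s) (hs1 : s ≤ 1)
    (t b : Fin 4 → Finset ι) (htb : ∀ l, t l ⊆ b l) {e : ι} (he : e ∈ b 0 ∪ b 1 ∪ b 3) :
    D4cyl p s t (Function.update b 2 ((b 2).erase e)) ≤ D4cyl p s t b := by
  have n02 : (0 : Fin 4) ≠ 2 := by decide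
  have n12 : (1 : Fin 4) ≠ 2 := by decide
  have n32 : (3 : Fin 4) ≠ 2 := by decide
  have h1s : 0 ≤ 1 - s := sub_nonneg.2 hs1
  unfold D4cyl
  rw [Function.update_self, Function.update_of_ne n02, Function.update_of_ne n12, Function.update_of_ne n32, union₄_erase₂ he]
  have u2 : cylMass p (b 2) ≤ cylMass p ((b 2).erase e) := cylMass_anti hp0 hp1 (erase_subset e (b 2))
  have u02 : cylMass p (b 0 ∪ b 2) ≤ cylMass p (b 0 ∪ (b 2).erase e) := cylMass_anti hp0 hp1 (union_subset_union subset_rfl (erase_subset e (b 2)))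
  have u12 : cylMass p (b 1 ∪ b 2) ≤ cylMass p (b 1 ∪ (b 2).erase e) := cylMass_anti hp0 hp1 (union_subset_union subset_rfl (erase_subset e (b 2)))
  have u23 : cylMass p (b 2 ∪ b 3) ≤ cylMass p ((b 2).erase e ∪ b 3) := cylMass_anti hp0 hp1 (union_subset_union (erase_subset e (b 2)) subset_rfl)
  have u012 : cylMass p (b 0 ∪ b 1 ∪ b 2) ≤ cylMass p (b 0 ∪ b 1 ∪ (b 2).erase e) := cylMass_anti hp0 hp1 (union_subset_union (union_subset_union subset_rfl subset_rfl) (erase_subset e (b 2)))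
  have u023 : cylMass p (b 0 ∪ b 2 ∪ b 3) ≤ cylMass p (b 0 ∪ (b 2).erase e ∪ b 3) := cylMass_anti hp0 hp1 (union_subset_union (union_subset_union subset_rfl (erase_subset e (b 2))) subset_rfl)
  have u123 : cylMass p (b 1 ∪ b 2 ∪ b 3) ≤ cylMass p (b 1 ∪ (b 2).erase e ∪ b 3) := cylMass_anti hp0 hp1 (union_subset_union (union_subset_union subset_rfl (erase_subset e (b 2))) subset_rfl)
  -- the coefficients: `E₃(M; others) ≥ 0` (gen 48 under the coin), `Cov(M; ·,·) ≥ 0`, `M ≥ 0`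
  have d0 : cylMass p (b 0) ≤ cylMass p (t 0) := cylMass_anti hp0 hp1 (htb 0)
  have d1 : cylMass p (b 1) ≤ cylMass p (t 1) := cylMass_anti hp0 hp1 (htb 1)
  have d3 : cylMass p (b 3) ≤ cylMass p (t 3) := cylMass_anti hp0 hp1 (htb 3)
  have hEX : 0 ≤ 2 * cylMass p (t 0 ∪ t 1 ∪ t 3) - cylMass p (t 0) * cylMass p (t 1 ∪ t 3) - cylMass p (t 3) * cylMass p (t 0 ∪ t 1) - cylMass p (t 1) * cylMass p (t 0 ∪ t 3) + cylMass p (t 0) * cylMass p (t 1) * cylMass p (t 3) := by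
    have h := E3cyl_nonneg hp0 hp1 ![t 0, t 1, t 3]
    simp only [Matrix.cons_val_zero, Matrix.cons_val_one, Matrix.cons_val_two, Matrix.head_cons, Matrix.tail_cons] at h
    linarith
  have hEY : 0 ≤ 2 * cylMass p (b 0 ∪ b 1 ∪ b 3) - cylMass p (b 0) * cylMass p (b 1 ∪ b 3) - cylMass p (b 3) * cylMass p (b 0 ∪ b 1) - cylMass p (b 1) * cylMass p (b 0 ∪ b 3) + cylMass p (b 0) * cylMass p (b 1) * cylMass p (b 3) := by
    have h := E3cyl_nonneg hp0 hp1 ![b 0, b 1, b 3]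
    simp only [Matrix.cons_val_zero, Matrix.cons_val_one, Matrix.cons_val_two, Matrix.head_cons, Matrix.tail_cons] at h
    linarith
  have hT : 0 ≤ 2 * cylMass p (b 0 ∪ b 1 ∪ b 3) + cylMass p (t 0) * cylMass p (t 1 ∪ t 3) - cylMass p (t 0) * cylMass p (b 1 ∪ b 3) - cylMass p (t 1) * cylMass p (b 0 ∪ b 3) - cylMass p (t 3) * cylMass p (b 0 ∪ b 1) + cylMass p (t 3) * cylMass p (t 0 ∪ t 1) - cylMass p (t 0 ∪ t 1) * cylMass p (b 3) + cylMass p (t 1) * cylMass p (t 0 ∪ t 3) - cylMass p (t 0 ∪ t 3) * cylMass p (b 1) - cylMass p (t 1 ∪ t 3) * cylMass p (b 0) - 2 * cylMass p (t 0) * cylMass p (t 1) * cylMass p (t 3) + cylMass p (t 0) * cylMass p (t 1) * cylMass p (b 3) + cylMass p (t 0) * cylMass p (t 3) * cylMass p (b 1) + cylMass p (t 1) * cylMass p (t 3) * cylMass p (b 0) := by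
    have h := T3cyl_nonneg hp0 hp1 (t := ![t 0, t 1, t 3]) (b := ![b 0, b 1, b 3]) (fun l => by fin_cases l <;> exact htb _)
    unfold T3cyl at h
    simp only [Matrix.cons_val_zero, Matrix.cons_val_one, Matrix.cons_val_two, Matrix.head_cons, Matrix.tail_cons] at h
    linarith
  have hE3 := coin_E3_nonneg hs0 hs1 d0 d1 d3 hEX hEY hT
  have hC01 := coin_cov_nonneg (s := s) hs0 hs1 d0 d1 (cylMass_mul_le_union hp0 hp1 (t 0) (t 1)) (cylMass_mul_le_union hp0 hp1 (b 0) (b 1))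
  have hC03 := coin_cov_nonneg (s := s) hs0 hs1 d0 d3 (cylMass_mul_le_union hp0 hp1 (t 0) (t 3)) (cylMass_mul_le_union hp0 hp1 (b 0) (b 3))
  have hC13 := coin_cov_nonneg (s := s) hs0 hs1 d1 d3 (cylMass_mul_le_union hp0 hp1 (t 1) (t 3)) (cylMass_mul_le_union hp0 hp1 (b 1) (b 3))
  have hM0 : 0 ≤ (s * cylMass p (t 0) + (1 - s) * cylMass p (b 0)) := add_nonneg (mul_nonneg hs0 (cylMass_nonneg hp0 _)) (mul_nonneg h1s (cylMass_nonneg hp0 _))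
  have hM1 : 0 ≤ (s * cylMass p (t 1) + (1 - s) * cylMass p (b 1)) := add_nonneg (mul_nonneg hs0 (cylMass_nonneg hp0 _)) (mul_nonneg h1s (cylMass_nonneg hp0 _))
  have hM3 : 0 ≤ (s * cylMass p (t 3) + (1 - s) * cylMass p (b 3)) := add_nonneg (mul_nonneg hs0 (cylMass_nonneg hp0 _)) (mul_nonneg h1s (cylMass_nonneg hp0 _))
  linarith [mul_nonneg (mul_nonneg h1s hE3) (sub_nonneg.2 u2), mul_nonneg (mul_nonneg h1s (sub_nonneg.2 hC13)) (sub_nonneg.2 u02), mul_nonneg (mul_nonneg h1s (sub_nonneg.2 hC03)) (sub_nonneg.2 u12), mul_nonneg (mul_nonneg h1s (sub_nonneg.2 hC01)) (sub_nonneg.2 u23), mul_nonneg (mul_nonneg h1s hM3) (sub_nonneg.2 u012), mul_nonneg (mul_nonneg h1s hM1) (sub_nonneg.2 u023), mul_nonneg (mul_nonneg h1s hM0) (sub_nonneg.2 u123)]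

/-- **Reduction step at slot `3`**: erasing from `b 3` a coordinate of another bottom can only decrease `Δ₄(s)`. [this work] -/
theorem D4cyl_erase_le₃ (hp0 : ∀ e, 0 ≤ p e) (hp1 : ∀ e, p e ≤ 1) {s : ℝ} (hs0 : 0 ≤ s) (hs1 : s ≤ 1)
    (t b : Fin 4 → Finset ι) (htb : ∀ l, t l ⊆ b l) {e : ι} (he : e ∈ b 0 ∪ b 1 ∪ b 2) :
    D4cyl p s t (Function.update b 3 ((b 3).erase e)) ≤ D4cyl p s t b := by
  have n03 : (0 : Fin 4) ≠ 3 := by decide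
  have n13 : (1 : Fin 4) ≠ 3 := by decide
  have n23 : (2 : Fin 4) ≠ 3 := by decide
  have h1s : 0 ≤ 1 - s := sub_nonneg.2 hs1
  unfold D4cyl
  rw [Function.update_self, Function.update_of_ne n03, Function.update_of_ne n13, Function.update_of_ne n23, union₄_erase₃ he]
  have u3 : cylMass p (b 3) ≤ cylMass p ((b 3).erase e) := cylMass_anti hp0 hp1 (erase_subset e (b 3))
  have u03 : cylMass p (b 0 ∪ b 3) ≤ cylMass p (b 0 ∪ (b 3).erase e) := cylMass_anti hp0 hp1 (union_subset_union subset_rfl (erase_subset e (b 3)))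
  have u13 : cylMass p (b 1 ∪ b 3) ≤ cylMass p (b 1 ∪ (b 3).erase e) := cylMass_anti hp0 hp1 (union_subset_union subset_rfl (erase_subset e (b 3)))
  have u23 : cylMass p (b 2 ∪ b 3) ≤ cylMass p (b 2 ∪ (b 3).erase e) := cylMass_anti hp0 hp1 (union_subset_union subset_rfl (erase_subset e (b 3)))
  have u013 : cylMass p (b 0 ∪ b 1 ∪ b 3) ≤ cylMass p (b 0 ∪ b 1 ∪ (b 3).erase e) := cylMass_anti hp0 hp1 (union_subset_union (union_subset_union subset_rfl subset_rfl) (erase_subset e (b 3)))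
  have u023 : cylMass p (b 0 ∪ b 2 ∪ b 3) ≤ cylMass p (b 0 ∪ b 2 ∪ (b 3).erase e) := cylMass_anti hp0 hp1 (union_subset_union (union_subset_union subset_rfl subset_rfl) (erase_subset e (b 3)))
  have u123 : cylMass p (b 1 ∪ b 2 ∪ b 3) ≤ cylMass p (b 1 ∪ b 2 ∪ (b 3).erase e) := cylMass_anti hp0 hp1 (union_subset_union (union_subset_union subset_rfl subset_rfl) (erase_subset e (b 3)))
  -- the coefficients: `E₃(M; others) ≥ 0` (gen 48 under the coin), `Cov(M; ·,·) ≥ 0`, `M ≥ 0`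
  have d0 : cylMass p (b 0) ≤ cylMass p (t 0) := cylMass_anti hp0 hp1 (htb 0)
  have d1 : cylMass p (b 1) ≤ cylMass p (t 1) := cylMass_anti hp0 hp1 (htb 1)
  have d2 : cylMass p (b 2) ≤ cylMass p (t 2) := cylMass_anti hp0 hp1 (htb 2)
  have hEX : 0 ≤ 2 * cylMass p (t 0 ∪ t 1 ∪ t 2) - cylMass p (t 0) * cylMass p (t 1 ∪ t 2) - cylMass p (t 2) * cylMass p (t 0 ∪ t 1) - cylMass p (t 1) * cylMass p (t 0 ∪ t 2) + cylMass p (t 0) * cylMass p (t 1) * cylMass p (t 2) := by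
    have h := E3cyl_nonneg hp0 hp1 ![t 0, t 1, t 2]
    simp only [Matrix.cons_val_zero, Matrix.cons_val_one, Matrix.cons_val_two, Matrix.head_cons, Matrix.tail_cons] at h
    linarith
  have hEY : 0 ≤ 2 * cylMass p (b 0 ∪ b 1 ∪ b 2) - cylMass p (b 0) * cylMass p (b 1 ∪ b 2) - cylMass p (b 2) * cylMass p (b 0 ∪ b 1) - cylMass p (b 1) * cylMass p (b 0 ∪ b 2) + cylMass p (b 0) * cylMass p (b 1) * cylMass p (b 2) := by
    have h := E3cyl_nonneg hp0 hp1 ![b 0, b 1, b 2]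
    simp only [Matrix.cons_val_zero, Matrix.cons_val_one, Matrix.cons_val_two, Matrix.head_cons, Matrix.tail_cons] at h
    linarith
  have hT : 0 ≤ 2 * cylMass p (b 0 ∪ b 1 ∪ b 2) + cylMass p (t 0) * cylMass p (t 1 ∪ t 2) - cylMass p (t 0) * cylMass p (b 1 ∪ b 2) - cylMass p (t 1) * cylMass p (b 0 ∪ b 2) - cylMass p (t 2) * cylMass p (b 0 ∪ b 1) + cylMass p (t 2) * cylMass p (t 0 ∪ t 1) - cylMass p (t 0 ∪ t 1) * cylMass p (b 2) + cylMass p (t 1) * cylMass p (t 0 ∪ t 2) - cylMass p (t 0 ∪ t 2) * cylMass p (b 1) - cylMass p (t 1 ∪ t 2) * cylMass p (b 0) - 2 * cylMass p (t 0) * cylMass p (t 1) * cylMass p (t 2) + cylMass p (t 0) * cylMass p (t 1) * cylMass p (b 2) + cylMass p (t 0) * cylMass p (t 2) * cylMass p (b 1) + cylMass p (t 1) * cylMass p (t 2) * cylMass p (b 0) := by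
    have h := T3cyl_nonneg hp0 hp1 (t := ![t 0, t 1, t 2]) (b := ![b 0, b 1, b 2]) (fun l => by fin_cases l <;> exact htb _)
    unfold T3cyl at h
    simp only [Matrix.cons_val_zero, Matrix.cons_val_one, Matrix.cons_val_two, Matrix.head_cons, Matrix.tail_cons] at h
    linarith
  have hE3 := coin_E3_nonneg hs0 hs1 d0 d1 d2 hEX hEY hT
  have hC01 := coin_cov_nonneg (s := s) hs0 hs1 d0 d1 (cylMass_mul_le_union hp0 hp1 (t 0) (t 1)) (cylMass_mul_le_union hp0 hp1 (b 0) (b 1))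
  have hC02 := coin_cov_nonneg (s := s) hs0 hs1 d0 d2 (cylMass_mul_le_union hp0 hp1 (t 0) (t 2)) (cylMass_mul_le_union hp0 hp1 (b 0) (b 2))
  have hC12 := coin_cov_nonneg (s := s) hs0 hs1 d1 d2 (cylMass_mul_le_union hp0 hp1 (t 1) (t 2)) (cylMass_mul_le_union hp0 hp1 (b 1) (b 2))
  have hM0 : 0 ≤ (s * cylMass p (t 0) + (1 - s) * cylMass p (b 0)) := add_nonneg (mul_nonneg hs0 (cylMass_nonneg hp0 _)) (mul_nonneg h1s (cylMass_nonneg hp0 _))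
  have hM1 : 0 ≤ (s * cylMass p (t 1) + (1 - s) * cylMass p (b 1)) := add_nonneg (mul_nonneg hs0 (cylMass_nonneg hp0 _)) (mul_nonneg h1s (cylMass_nonneg hp0 _))
  have hM2 : 0 ≤ (s * cylMass p (t 2) + (1 - s) * cylMass p (b 2)) := add_nonneg (mul_nonneg hs0 (cylMass_nonneg hp0 _)) (mul_nonneg h1s (cylMass_nonneg hp0 _))
  linarith [mul_nonneg (mul_nonneg h1s hE3) (sub_nonneg.2 u3), mul_nonneg (mul_nonneg h1s (sub_nonneg.2 hC12)) (sub_nonneg.2 u03), mul_nonneg (mul_nonneg h1s (sub_nonneg.2 hC02)) (sub_nonneg.2 u13), mul_nonneg (mul_nonneg h1s (sub_nonneg.2 hC01)) (sub_nonneg.2 u23), mul_nonneg (mul_nonneg h1s hM2) (sub_nonneg.2 u013), mul_nonneg (mul_nonneg h1s hM1) (sub_nonneg.2 u023), mul_nonneg (mul_nonneg h1s hM0) (sub_nonneg.2 u123)]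

end

end Summit.CriticalPhenomena.PercolationContinuityZ3.Theorems.SahiTangentCyl
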